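import Mathlib
import HarnessLib
import Summits.HubbardSuperconductivity.HubbardSuperconductivity.Theorems.KLProgrammeKLRegimeEngineAnisoTorusSumWtFlow

/-!
# K3 ENGINE child (stmt-HubbardSuperconductivity-20437), stub (b) conjunct 3 ((E4)ₙ supply, W1): the weighted torus bound of a level-`n` sector function
# REINDEXED on the position group `ZMod (4M) × (ℤ/L)²` of the engine's decay bookkeeping

Cell `gate-hubbard-kl`, seat p3 (g10).  `anisoTorusSumWt_flow` (…EngineAnisoTorusSumWtFlow) sums over `dw ∈ TorusSite 1 (4M) × TorusSite 2 L` (the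
`IsoTorusBoundAt` convention); k3c3-p2's `sum_klScaleWt_mul_norm_starConv_le` indexes leg kernels by `z ∈ ZMod (4M) × TorusSite 2 L`.  This file is
the reindexing (`Equiv.funUnique (Fin 1)`): **`anisoTorusSumWt_flow_grid`** — the same absolute `T_W`, the sum over `z`, the time character read at
`fun _ => z.1`, the weight `1 + Λ_n·gridLabelDist z 0`.

Pure bookkeeping; nothing about the model is asserted.
-/

noncomputable section

namespace Summit.HubbardSuperconductivity.HubbardSuperconductivity.Theorems.TorusFourierL2

set_option linter.dupNamespace false -- summit = problem name (single-conjunct summit), D-0017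

open Finset Literature.MathematicalPhysics.QuantumLattice Literature.Probability.LatticeModels
open Summit.HubbardSuperconductivity.HubbardSuperconductivity.Theorems.DispersionFlow
open Summit.HubbardSuperconductivity.HubbardSuperconductivity.Theorems.KLRegimeSplit
open Summit.HubbardSuperconductivity.HubbardSuperconductivity.Theorems.KLProgrammeLegKernels
open scoped Real ComplexConjugate

/-- **W1 on the grid group `ZMod (4M) × (ℤ/L)²`.**  There is ONE absolute `T_W > 0` such that, under the binders of `E4FlowAt` (with the producers' door
`U ≤ min (klEngU₀3 P R cc) (1/(Gfr₃+1))`), for every sector `ω` of scale `n` and orientation `c'`: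
`(|β|L²)⁻¹ Σ_{z} (1 + Λ_n·gridLabelDist z 0)·‖Σ_k klAnisoFamily … K_n klE0 n ω k · Χ_{c'}(k; z)‖ ≤ T_W/ε_x`.
[cite: BenfattoGiulianiMastropietro2006, Lemma 2.2, §2.6 (2.81), §2.8 (2.77)] -/
theorem anisoTorusSumWt_flow_grid :
    ∃ TW : ℝ, 0 < TW ∧
      ∀ (G : GeoConsts) (P : SplitConsts) (R : RenConsts) (Q : EngConsts) (cc : ℝ), R.WF2 → 0 < cc → cc ≤ EngineV8.klEngC₃6 P R →
      ∀ μ ∈ klWindowC, ∀ U : ℝ, 0 < U → U ≤ min (EngineV8.klEngU₀3 P R cc) (1 / (R.Gfr 3 + 1)) →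
      ∀ β : ℝ, klBetaMin ≤ β → β ≤ Real.exp (cc / U ^ 2) →
      ∀ (L M : ℕ) [NeZero L] [NeZero M], EngineV8.klEngL₃ β U ≤ L → EngineV8.klEngM₃ β U L ≤ M →
      ∀ n : ℕ, 1 ≤ n → n ≤ nScales β + 1 →
        HistP klPredsV17F2 L M G P Q R β U μ 0 n → FrameOK R U (nScales β) μ (klFlowFrameU L M β U μ n) →
        ∀ (ω : Fin (sectorCount n)) (c' : Fin 2),
          1 / (|β| * (L : ℝ) ^ 2) *
              ∑ z : ZMod (2 * (2 * M)) × TorusSite 2 L,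
                (1 + klScale klE0 n * EngineV8.gridLabelDist L (2 * (2 * M)) β z 0) *
                ‖∑ k : FreqMomentum L M, klAnisoFamily L M β μ (klFlowFrameU L M β U μ n) klE0 n ω k *
                  (if c' = 0 then torusChar (fun _ : Fin 1 => ((k.1 : ℕ) : ZMod (2 * (2 * M)))) (fun _ => z.1) * torusChar k.2 z.2
                    else conj (torusChar (fun _ : Fin 1 => ((k.1 : ℕ) : ZMod (2 * (2 * M)))) (fun _ => z.1) * torusChar k.2 z.2))‖ ≤
            TW / imagTimeWeight β M := by
  obtain ⟨TW, hTW, h⟩ := anisoTorusSumWt_flow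
  refine ⟨TW, hTW, ?_⟩
  intro G P R Q cc hR2 hcc hcc6 μ hμ U hU hUle β hβmin hβc L M _ _ hL3 hM3 n hn1 hnN hhist hfr ω c'
  have hmain := h G P R Q cc hR2 hcc hcc6 μ hμ U hU hUle β hβmin hβc L M hL3 hM3 n hn1 hnN hhist hfr ω c'
  -- reindex `dw ↦ (dw.1 0, dw.2)`
  let e : TorusSite 1 (2 * (2 * M)) × TorusSite 2 L ≃ ZMod (2 * (2 * M)) × TorusSite 2 L :=
    (Equiv.funUnique (Fin 1) (ZMod (2 * (2 * M)))).prodCongr (Equiv.refl _)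
  have hsum : ∑ dw : TorusSite 1 (2 * (2 * M)) × TorusSite 2 L,
        (1 + klScale klE0 n * EngineV8.gridLabelDist L (2 * (2 * M)) β ((dw.1 0), dw.2) 0) *
        ‖∑ k : FreqMomentum L M, klAnisoFamily L M β μ (klFlowFrameU L M β U μ n) klE0 n ω k *
          (if c' = 0 then torusChar (fun _ : Fin 1 => ((k.1 : ℕ) : ZMod (2 * (2 * M)))) dw.1 * torusChar k.2 dw.2
            else conj (torusChar (fun _ : Fin 1 => ((k.1 : ℕ) : ZMod (2 * (2 * M)))) dw.1 * torusChar k.2 dw.2))‖ =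
      ∑ z : ZMod (2 * (2 * M)) × TorusSite 2 L,
        (1 + klScale klE0 n * EngineV8.gridLabelDist L (2 * (2 * M)) β z 0) *
        ‖∑ k : FreqMomentum L M, klAnisoFamily L M β μ (klFlowFrameU L M β U μ n) klE0 n ω k *
          (if c' = 0 then torusChar (fun _ : Fin 1 => ((k.1 : ℕ) : ZMod (2 * (2 * M)))) (fun _ => z.1) * torusChar k.2 z.2
            else conj (torusChar (fun _ : Fin 1 => ((k.1 : ℕ) : ZMod (2 * (2 * M)))) (fun _ => z.1) * torusChar k.2 z.2))‖ := by
    refine Fintype.sum_equiv e _ _ fun dw => ?_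
    have h1 : (fun _ : Fin 1 => (e dw).1) = dw.1 := by
      funext i
      rw [Fin.fin_one_eq_zero i]
      rfl
    have h2 : (e dw).2 = dw.2 := rfl
    have h3 : e dw = ((dw.1 0), dw.2) := rfl
    rw [h1, h2, h3]
  rw [← hsum]
  exact hmain

end Summit.HubbardSuperconductivity.HubbardSuperconductivity.Theorems.TorusFourierL2

end
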